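import Literature.NumberTheory.Automorphic.UnitaryLevelOrbitalIntegralLatticeCount   -- ★-twin (F2): `finsum_mem_fixedBy_eq_ncard_sep`, `ncard_sep_fixedBy_level_eq_ncard_selfDual_level`
import Literature.NumberTheory.Automorphic.UnitOrbitalIntegralFixedPointsPair          -- ★ `cmLocalIntegralLevel_one_eq_top_of_smul_eq`, `compactSpace_cmDatum_local_one_of_smul_eq`, `compactSpace_centralizer_prod`
import Literature.NumberTheory.Automorphic.UnitaryUnitOrbitalIntegralLatticeCount      -- ★ (L5) `isUnit_placeForm_antidiagOne`, `unit_placeForm_antidiagOne_mem_glInt`, `antidiagOne_isHermitian`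
import HarnessLib

/-!
# The LEVEL-`c` lattice-count socket on the endoscopic side `H_v = U(Φ₂)(L⁺_v) × U(Φ₁)(L⁺_v)`: `Φ(⟦γ_H⟧, f; m_H) = #{Λ self-dual : γ_{2,w}Λ = Λ,
# (1 + c⁻¹(γ_{2,w} − 1))Λ ⊆ Λ}` for a `K_H`-class function `f` cutting out «`(h_2)_w ≡ 1 (mod c)`» (Rogawski 1990 §4.9; the H-side rows of the S3 table)

Topic `NumberTheory/Automorphic`; namespace `Literature.NumberTheory.Automorphic`.  THEOREMS ONLY (no definition, no instance, no notation, no named fact,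
no `sorry`).  Cell `pub/hodgecm-mathlib`, crux H413, road «S3-tree» bricks **T6-2b ∕ O8c** (H-side level values near 1: T3′'s `χ₀ = 1_{K_H(1) on the U(Φ₂) factor}`),
END∕T6 holder F0P3a-p03 (g14).  HC_CM is proved only modulo the cell's 2 remaining named inputs (hLiu418, h413) until rung 0 closes; unconditional bookkeeping.

* §1 `ncard_sep_fixedBy_prod_top` — separated fixed cosets on `(A × B) ⧸ (K_A ×ˢ B)` are the separated fixed cosets on `A ⧸ K_A` when the separating predicate reads
  the first factor (the rank-one factor `U(Φ₁)(L⁺_v) = U(Φ₁)(𝒪_v)` at a non-split place, ★ `cmLocalIntegralLevel_one_eq_top_of_smul_eq`).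
* §2 `classOrbitalIntegral_level_prod_eq_ncard_selfDual_level` — THE `H`-SIDE LEVEL SOCKET: weighted unfolding (★ (U1)) ∘ ★-twin `finsum_mem_fixedBy_eq_ncard_sep` ∘ §1 ∘
  ★-twin `ncard_sep_fixedBy_level_eq_ncard_selfDual_level` (`N = 2`, `H = Φ₂`).  Downstream: ★ A-p13 level-ball counts (type (1)) and ★ T6-2 (type (2)).

## References
* [Rogawski1990] J. D. Rogawski, *Automorphic Representations of Unitary Groups in Three Variables* (1990), §4.9 Prop. 4.9.1 (b) p. 55, §4.3 (4.3.1) p. 43.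
* [Kottwitz1986] R. E. Kottwitz, Compositio Math. 60 (1986), §3.
* [Laumon1995] G. Laumon, *Cohomology of Drinfeld Modular Varieties* I (1996), Lemma (5.3.2) p. 136.
* [BourbakiGT1] N. Bourbaki, *General Topology* I, Ch. III §2.
-/

set_option autoImplicit false

noncomputable section

open MeasureTheory Measure Topology Set Function NumberField IsDedekindDomain ValuativeRel
open scoped ENNReal NNReal Matrix MatrixGroups ValuativeRel
open Literature.NumberTheory.Rogawski1990

namespace Literature.NumberTheory.Automorphic

open UnitaryGroup

/-! ## §1 Separated fixed cosets on a product whose second level is everything -/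

section Product

variable {A B : Type*} [Group A] [Group B] (KA : Subgroup A) (KB : Subgroup B)

/-- **`#{q ∈ Fix_p((A × B) ⧸ (K_A ×ˢ K_B)) : Y((q⁻¹ p q)₁)} = #{r ∈ Fix_{p₁}(A ⧸ K_A) : Y(r⁻¹ p₁ r)}` when `K_B = B`** and `Y` is `K_A`-conjugation invariant
(`q ↦ q₁`; the second factor contributes one coset). [cite: BourbakiGT1, Ch. III §2] -/
theorem ncard_sep_fixedBy_prod_top (hKB : KB = ⊤) (p : A × B) (Y : A → Prop) (hY : ∀ k ∈ KA, ∀ x, Y (k⁻¹ * x * k) ↔ Y x) :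
    {q ∈ MulAction.fixedBy ((A × B) ⧸ KA.prod KB) p | Y ((q.out⁻¹ * p * q.out).1)}.ncard =
      {r ∈ MulAction.fixedBy (A ⧸ KA) p.1 | Y (r.out⁻¹ * p.1 * r.out)}.ncard := by
  classical
  subst hKB
  -- representatives
  have hrepA : ∀ g : A, Y ((g : A ⧸ KA).out⁻¹ * p.1 * (g : A ⧸ KA).out) ↔ Y (g⁻¹ * p.1 * g) := fun g => by
    obtain ⟨k, hk⟩ := QuotientGroup.mk_out_eq_mul KA g
    rw [hk, mul_inv_rev, show (k : A)⁻¹ * g⁻¹ * p.1 * (g * k) = (k : A)⁻¹ * (g⁻¹ * p.1 * g) * k by group]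
    exact hY _ k.2 _
  have hrepP : ∀ g : A × B, Y (((g : (A × B) ⧸ KA.prod ⊤).out⁻¹ * p * (g : (A × B) ⧸ KA.prod ⊤).out).1) ↔ Y (g.1⁻¹ * p.1 * g.1) := fun g => by
    obtain ⟨k, hk⟩ := QuotientGroup.mk_out_eq_mul (KA.prod ⊤) g
    have hk1 : (k : A × B).1 ∈ KA := (Subgroup.mem_prod.1 k.2).1
    rw [hk, Prod.fst_mul, Prod.fst_mul, Prod.fst_inv, Prod.fst_mul, mul_inv_rev,
      show ((k : A × B).1)⁻¹ * g.1⁻¹ * p.1 * (g.1 * (k : A × B).1) = ((k : A × B).1)⁻¹ * (g.1⁻¹ * p.1 * g.1) * (k : A × B).1 by group]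
    exact hY _ hk1 _
  -- fixedness on both sides
  have hfixA : ∀ g : A, (g : A ⧸ KA) ∈ MulAction.fixedBy (A ⧸ KA) p.1 ↔ g⁻¹ * p.1 * g ∈ KA := fun g => mem_fixedBy_quotient_mk_iff KA p.1 g
  have hfixP : ∀ g : A × B, (g : (A × B) ⧸ KA.prod ⊤) ∈ MulAction.fixedBy ((A × B) ⧸ KA.prod ⊤) p ↔ g.1⁻¹ * p.1 * g.1 ∈ KA := fun g => by
    rw [mem_fixedBy_quotient_mk_iff, Subgroup.mem_prod]
    simp only [Prod.fst_mul, Prod.fst_inv, Prod.snd_mul, Prod.snd_inv, Subgroup.mem_top, and_true]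
  refine Set.ncard_congr (fun q _ => ((q.out.1 : A) : A ⧸ KA)) ?_ ?_ ?_
  · rintro q ⟨hq, hYq⟩
    have hq' := hq
    rw [← QuotientGroup.out_eq' q, hfixP] at hq'
    rw [← QuotientGroup.out_eq' q, hrepP] at hYq
    exact ⟨(hfixA _).2 hq', (hrepA _).2 hYq⟩
  · intro q q' _ _ h
    rw [← QuotientGroup.out_eq' q, ← QuotientGroup.out_eq' q']
    refine QuotientGroup.eq.2 (Subgroup.mem_prod.2 ⟨?_, Subgroup.mem_top _⟩)
    rw [Prod.fst_mul, Prod.fst_inv]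
    exact QuotientGroup.eq.1 h
  · rintro r ⟨hr, hYr⟩
    refine ⟨((r.out, (1 : B)) : (A × B) ⧸ KA.prod ⊤), ⟨?_, ?_⟩, ?_⟩
    · rw [hfixP]
      have := (hfixA r.out).1 (by rw [QuotientGroup.out_eq']; exact hr)
      exact this
    · rw [hrepP]; exact (hrepA r.out).1 (by rw [QuotientGroup.out_eq']; exact hYr)
    · obtain ⟨k, hk⟩ := QuotientGroup.mk_out_eq_mul (KA.prod ⊤) (r.out, (1 : B))
      show (((((r.out, (1 : B)) : (A × B) ⧸ KA.prod ⊤).out).1 : A) : A ⧸ KA) = r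
      rw [hk, Prod.fst_mul]
      conv_rhs => rw [← QuotientGroup.out_eq' r]
      refine QuotientGroup.eq.2 ?_
      rw [mul_inv_rev, show ((Quotient.out r, (1 : B)) : A × B).1 = r.out from rfl, mul_assoc, inv_mul_cancel, mul_one]
      exact inv_mem (Subgroup.mem_prod.1 k.2).1

end Product

/-! ## §2 THE `H`-SIDE LEVEL SOCKET at the letter carriers `Φ₂, Φ₁`, non-split unramified `v` -/

section H

/-- **LEVEL-SEPARATED FIXED COSETS OF `H_v ⧸ K_H` ↔ SELF-DUAL LEVEL LATTICES FOR THE `U(Φ₂)` COMPONENT** (the algebraic half of the `H`-side level socket):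
`#{q ∈ Fix_{γ_H}(H_v ⧸ (K₂ ×ˢ K₁)) : ((q⁻¹γ_Hq)₂)_w ≡ 1 (mod c)} = #{Λ self-dual : γ_{2,w}Λ = Λ, (1 + c⁻¹(γ_{2,w} − 1))Λ ⊆ Λ}` at a non-split unramified `v`
(§1 with `K₁ = U(Φ₁)_v` ∘ ★-twin `ncard_sep_fixedBy_level_eq_ncard_selfDual_level`). [cite: Kottwitz1986, §3] [cite: Laumon1995, Lemma (5.3.2) p. 136] -/
theorem ncard_sep_fixedBy_prod_level_eq_ncard_selfDual_level (L : Type) [Field L] [NumberField L] [IsCMField L]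
    (v : HeightOneSpectrum (𝓞 ↥(maximalRealSubfield L))) (γH : ((cmDatum L 2 (Matrix.of fun i j : Fin 2 => if i.val + j.val + 1 = 2 then (1 : L) else 0)).Local v × (cmDatum L 1 (Matrix.of fun i j : Fin 1 => if i.val + j.val + 1 = 1 then (1 : L) else 0)).Local v))
    (w : UnitaryGroup.PlacesOver L v) (hw : IsCMField.complexConj L • w.1 = w.1) (hv : Algebra.IsUnramifiedIn (𝓞 L) v.asIdeal)
    {c : w.1.adicCompletion L} (hc0 : c ≠ 0) (hc1 : valuation (w.1.adicCompletion L) c < 1) :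
    {q ∈ MulAction.fixedBy (((cmDatum L 2 (Matrix.of fun i j : Fin 2 => if i.val + j.val + 1 = 2 then (1 : L) else 0)).Local v × (cmDatum L 1 (Matrix.of fun i j : Fin 1 => if i.val + j.val + 1 = 1 then (1 : L) else 0)).Local v) ⧸ (((cmLocalIntegralLevel L 2 (Matrix.of fun i j : Fin 2 => if i.val + j.val + 1 = 2 then (1 : L) else 0) v).prod (cmLocalIntegralLevel L 1 (Matrix.of fun i j : Fin 1 => if i.val + j.val + 1 = 1 then (1 : L) else 0) v) : Subgroup ((cmDatum L 2 (Matrix.of fun i j : Fin 2 => if i.val + j.val + 1 = 2 then (1 : L) else 0)).Local v × (cmDatum L 1 (Matrix.of fun i j : Fin 1 => if i.val + j.val + 1 = 1 then (1 : L) else 0)).Local v)))) γH | (∀ a b, valuation (w.1.adicCompletion L) (((((((localNonsplitEquiv (IsCMField.complexConj L) (Matrix.of fun i j : Fin 2 => if i.val + j.val + 1 = 2 then (1 : L) else 0) (IsCMField.complexConj_ne_one L) w hw) (q.out⁻¹ * γH * q.out).1 : ↥(unitaryGroupOfForm (galAdicCompletionMap (L := L) (IsCMField.complexConj L) hw) (placeForm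 (Matrix.of fun i j : Fin 2 => if i.val + j.val + 1 = 2 then (1 : L) else 0) w.1))) : GL (Fin 2) (w.1.adicCompletion L))) : Matrix (Fin 2) (Fin 2) (w.1.adicCompletion L)) - 1) a b) ≤ valuation (w.1.adicCompletion L) c)}.ncard =
      {Λ : Submodule 𝒪[w.1.adicCompletion L] (Fin 2 → w.1.adicCompletion L) |
        (∃ g : GL (Fin 2) (w.1.adicCompletion L),
          (∃ J' ∈ glInt 2 (w.1.adicCompletion L), (J' : Matrix (Fin 2) (Fin 2) (w.1.adicCompletion L)) =
            formCongr (galAdicCompletionMap (L := L) (IsCMField.complexConj L) hw) g (placeForm (Matrix.of fun i j : Fin 2 => if i.val + j.val + 1 = 2 then (1 : L) else 0) w.1)) ∧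
          Λ = Submodule.span 𝒪[w.1.adicCompletion L] (Set.range ((g : Matrix (Fin 2) (Fin 2) (w.1.adicCompletion L)))ᵀ)) ∧
        Λ.map ((Matrix.toLin' ((((localNonsplitEquiv (IsCMField.complexConj L) (Matrix.of fun i j : Fin 2 => if i.val + j.val + 1 = 2 then (1 : L) else 0) (IsCMField.complexConj_ne_one L) w hw) γH.1 : ↥(unitaryGroupOfForm (galAdicCompletionMap (L := L) (IsCMField.complexConj L) hw) (placeForm (Matrix.of fun i j : Fin 2 => if i.val + j.val + 1 = 2 then (1 : L) else 0) w.1))) : GL (Fin 2) (w.1.adicCompletion L)) : Matrix (Fin 2) (Fin 2) (w.1.adicCompletion L))).restrictScalars 𝒪[w.1.adicCompletion L]) = Λ ∧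
        Λ.map ((Matrix.toLin' (1 + c⁻¹ • (((((localNonsplitEquiv (IsCMField.complexConj L) (Matrix.of fun i j : Fin 2 => if i.val + j.val + 1 = 2 then (1 : L) else 0) (IsCMField.complexConj_ne_one L) w hw) γH.1 : ↥(unitaryGroupOfForm (galAdicCompletionMap (L := L) (IsCMField.complexConj L) hw) (placeForm (Matrix.of fun i j : Fin 2 => if i.val + j.val + 1 = 2 then (1 : L) else 0) w.1))) : GL (Fin 2) (w.1.adicCompletion L)) : Matrix (Fin 2) (Fin 2) (w.1.adicCompletion L)) - 1))).restrictScalars 𝒪[w.1.adicCompletion L]) ≤ Λ}.ncard := by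
  -- `K_v`-conjugation invariance of the level predicate on the `U(Φ₂)` factor (elements typed on the `«local»` carrier)
  have hYK : ∀ k : «local» L (IsCMField.complexConj L) 2 (Matrix.of fun i j : Fin 2 => if i.val + j.val + 1 = 2 then (1 : L) else 0) v, k ∈ localIntegralLevel (IsCMField.complexConj L) 2 (Matrix.of fun i j : Fin 2 => if i.val + j.val + 1 = 2 then (1 : L) else 0) v →
      ∀ x : «local» L (IsCMField.complexConj L) 2 (Matrix.of fun i j : Fin 2 => if i.val + j.val + 1 = 2 then (1 : L) else 0) v,
      (∀ a b, valuation (w.1.adicCompletion L) (((((((localNonsplitEquiv (IsCMField.complexConj L) (Matrix.of fun i j : Fin 2 => if i.val + j.val + 1 = 2 then (1 : L) else 0) (IsCMField.complexConj_ne_one L) w hw) (k⁻¹ * x * k) : ↥(unitaryGroupOfForm (galAdicCompletionMap (L := L) (IsCMField.complexConj L) hw) (placeForm (Matrix.of fun i j : Fin 2 => if i.val + j.val + 1 = 2 then (1 : L) else 0) w.1))) : GL (Fin 2) (w.1.adicCompletion L))) : Matrix (Fin 2) (Fin 2) (w.1.adicCompletion L)) - 1) a b) ≤ valuation (w.1.adicCompletion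 L) c) ↔ (∀ a b, valuation (w.1.adicCompletion L) (((((((localNonsplitEquiv (IsCMField.complexConj L) (Matrix.of fun i j : Fin 2 => if i.val + j.val + 1 = 2 then (1 : L) else 0) (IsCMField.complexConj_ne_one L) w hw) x : ↥(unitaryGroupOfForm (galAdicCompletionMap (L := L) (IsCMField.complexConj L) hw) (placeForm (Matrix.of fun i j : Fin 2 => if i.val + j.val + 1 = 2 then (1 : L) else 0) w.1))) : GL (Fin 2) (w.1.adicCompletion L))) : Matrix (Fin 2) (Fin 2) (w.1.adicCompletion L)) - 1) a b) ≤ valuation (w.1.adicCompletion L) c) := fun k hk x => by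
    have hk' := (mem_localIntegralLevel_iff_of_smul_eq (IsCMField.complexConj L) 2 (Matrix.of fun i j : Fin 2 => if i.val + j.val + 1 = 2 then (1 : L) else 0) (IsCMField.complexConj_ne_one L) w hw k).1 hk
    rw [map_mul, map_mul, map_inv, Subgroup.coe_mul, Subgroup.coe_mul, Subgroup.coe_inv]
    exact level_conj_iff_of_mem_glInt hc0 hk' _
  -- the `U(Φ₁)` factor is its own level: `K₁ = ⊤` (§1)
  rw [ncard_sep_fixedBy_prod_top (cmLocalIntegralLevel L 2 (Matrix.of fun i j : Fin 2 => if i.val + j.val + 1 = 2 then (1 : L) else 0) v) (cmLocalIntegralLevel L 1 (Matrix.of fun i j : Fin 1 => if i.val + j.val + 1 = 1 then (1 : L) else 0) v)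
    (cmLocalIntegralLevel_one_eq_top_of_smul_eq L (Matrix.of fun i j : Fin 1 => if i.val + j.val + 1 = 1 then (1 : L) else 0) w hw (isUnit_placeForm_antidiagOne (E := L) 1 w.1)) γH
    (fun x₂ : (cmDatum L 2 (Matrix.of fun i j : Fin 2 => if i.val + j.val + 1 = 2 then (1 : L) else 0)).Local v => (∀ a b, valuation (w.1.adicCompletion L) (((((((localNonsplitEquiv (IsCMField.complexConj L) (Matrix.of fun i j : Fin 2 => if i.val + j.val + 1 = 2 then (1 : L) else 0) (IsCMField.complexConj_ne_one L) w hw) x₂ : ↥(unitaryGroupOfForm (galAdicCompletionMap (L := L) (IsCMField.complexConj L) hw) (placeForm (Matrix.of fun i j : Fin 2 => if i.val + j.val + 1 = 2 then (1 : L) else 0) w.1))) : GL (Fin 2) (w.1.adicCompletion L))) : Matrix (Fin 2) (Fin 2) (w.1.adicCompletion L)) - 1) a b) ≤ valuation (w.1.adicCompletion L) c)) hYK]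
  exact ncard_sep_fixedBy_level_eq_ncard_selfDual_level L 2 (Matrix.of fun i j : Fin 2 => if i.val + j.val + 1 = 2 then (1 : L) else 0) (IsCMField.complexConj_ne_one L) w hw (antidiagOne_isHermitian L 2) γH.1 hv
    (isUnit_placeForm_antidiagOne (E := L) 2 w.1) (unit_placeForm_antidiagOne_mem_glInt (E := L) 2 w.1) hc0 hc1

variable (L : Type) [Field L] [NumberField L] [IsCMField L] (v : HeightOneSpectrum (𝓞 ↥(maximalRealSubfield L)))
  [MeasurableSpace ((cmDatum L 2 (Matrix.of fun i j : Fin 2 => if i.val + j.val + 1 = 2 then (1 : L) else 0)).Local v × (cmDatum L 1 (Matrix.of fun i j : Fin 1 => if i.val + j.val + 1 = 1 then (1 : L) else 0)).Local v)]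
  [BorelSpace ((cmDatum L 2 (Matrix.of fun i j : Fin 2 => if i.val + j.val + 1 = 2 then (1 : L) else 0)).Local v × (cmDatum L 1 (Matrix.of fun i j : Fin 1 => if i.val + j.val + 1 = 1 then (1 : L) else 0)).Local v)]
  [∀ a : (cmDatum L 2 (Matrix.of fun i j : Fin 2 => if i.val + j.val + 1 = 2 then (1 : L) else 0)).Local v × (cmDatum L 1 (Matrix.of fun i j : Fin 1 => if i.val + j.val + 1 = 1 then (1 : L) else 0)).Local v,
    MeasurableSpace (((cmDatum L 2 (Matrix.of fun i j : Fin 2 => if i.val + j.val + 1 = 2 then (1 : L) else 0)).Local v × (cmDatum L 1 (Matrix.of fun i j : Fin 1 => if i.val + j.val + 1 = 1 then (1 : L) else 0)).Local v) ⧸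
      Subgroup.centralizer ({a} : Set ((cmDatum L 2 (Matrix.of fun i j : Fin 2 => if i.val + j.val + 1 = 2 then (1 : L) else 0)).Local v × (cmDatum L 1 (Matrix.of fun i j : Fin 1 => if i.val + j.val + 1 = 1 then (1 : L) else 0)).Local v)))]
  [∀ a : (cmDatum L 2 (Matrix.of fun i j : Fin 2 => if i.val + j.val + 1 = 2 then (1 : L) else 0)).Local v × (cmDatum L 1 (Matrix.of fun i j : Fin 1 => if i.val + j.val + 1 = 1 then (1 : L) else 0)).Local v,
    BorelSpace (((cmDatum L 2 (Matrix.of fun i j : Fin 2 => if i.val + j.val + 1 = 2 then (1 : L) else 0)).Local v × (cmDatum L 1 (Matrix.of fun i j : Fin 1 => if i.val + j.val + 1 = 1 then (1 : L) else 0)).Local v) ⧸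
      Subgroup.centralizer ({a} : Set ((cmDatum L 2 (Matrix.of fun i j : Fin 2 => if i.val + j.val + 1 = 2 then (1 : L) else 0)).Local v × (cmDatum L 1 (Matrix.of fun i j : Fin 1 => if i.val + j.val + 1 = 1 then (1 : L) else 0)).Local v)))]
  (νH : Measure ((cmDatum L 2 (Matrix.of fun i j : Fin 2 => if i.val + j.val + 1 = 2 then (1 : L) else 0)).Local v × (cmDatum L 1 (Matrix.of fun i j : Fin 1 => if i.val + j.val + 1 = 1 then (1 : L) else 0)).Local v)) [IsHaarMeasure νH] [νH.IsMulRightInvariant]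

/-- **THE `H`-SIDE LEVEL SOCKET — `Φ(⟦γ_H⟧, f; m_H) = #{Λ self-dual : γ_{2,w}Λ = Λ, (1 + c⁻¹(γ_{2,w} − 1))Λ ⊆ Λ}`** for `m_H` canonical for `(IsLocalGRegular, ν_H)`,
`ν_H(K₂ ×ˢ K₁) = 1`, `γ_H = (γ₂, γ₁)` `G`-regular with `Z(γ₂)` compact, `v` non-split (`c • w = w`) and unramified, `0 < |c| < 1`, and a CONTINUOUS test function
`f : H_v → ℂ` supported in `K_H = K₂ ×ˢ K₁`, `K_H`-conjugation invariant, equal on `K_H` to the characteristic function of «`(h₂)_w ≡ 1 (mod c)`» (for `c = ϖ_w`: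
T3′'s `χ₀ = 1_{K_H}·[h̄_{2,w} = 1]`).  ★ (U1) ∘ ★-twin §2 ∘ §1 (`K₁ = U(Φ₁)_v`, ★ `cmLocalIntegralLevel_one_eq_top_of_smul_eq`) ∘ ★-twin `ncard_sep_fixedBy_level_eq_ncard_selfDual_level`.
[cite: Rogawski1990, §4.9 Prop. 4.9.1 (b) p. 55; §4.3 (4.3.1) p. 43] [cite: Kottwitz1986, §3] [cite: Laumon1995, Lemma (5.3.2) p. 136] -/
theorem classOrbitalIntegral_level_prod_eq_ncard_selfDual_level
    {mH : OrbitalMeasureFamily ((cmDatum L 2 (Matrix.of fun i j : Fin 2 => if i.val + j.val + 1 = 2 then (1 : L) else 0)).Local v × (cmDatum L 1 (Matrix.of fun i j : Fin 1 => if i.val + j.val + 1 = 1 then (1 : L) else 0)).Local v)} (hmH : mH.IsCanonical (IsLocalGRegular L v) νH)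
    (hνH : νH ((((cmLocalIntegralLevel L 2 (Matrix.of fun i j : Fin 2 => if i.val + j.val + 1 = 2 then (1 : L) else 0) v).prod (cmLocalIntegralLevel L 1 (Matrix.of fun i j : Fin 1 => if i.val + j.val + 1 = 1 then (1 : L) else 0) v) : Subgroup ((cmDatum L 2 (Matrix.of fun i j : Fin 2 => if i.val + j.val + 1 = 2 then (1 : L) else 0)).Local v × (cmDatum L 1 (Matrix.of fun i j : Fin 1 => if i.val + j.val + 1 = 1 then (1 : L) else 0)).Local v))) : Set ((cmDatum L 2 (Matrix.of fun i j : Fin 2 => if i.val + j.val + 1 = 2 then (1 : L) else 0)).Local v × (cmDatum L 1 (Matrix.of fun i j : Fin 1 => if i.val + j.val + 1 = 1 then (1 : L) else 0)).Local v)) = 1)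
    (γH : ((cmDatum L 2 (Matrix.of fun i j : Fin 2 => if i.val + j.val + 1 = 2 then (1 : L) else 0)).Local v × (cmDatum L 1 (Matrix.of fun i j : Fin 1 => if i.val + j.val + 1 = 1 then (1 : L) else 0)).Local v)) (hγ : IsLocalGRegular L v γH)
    [CompactSpace (Subgroup.centralizer ({γH.1} : Set ((cmDatum L 2 (Matrix.of fun i j : Fin 2 => if i.val + j.val + 1 = 2 then (1 : L) else 0)).Local v)))]
    (w : UnitaryGroup.PlacesOver L v) (hw : IsCMField.complexConj L • w.1 = w.1) (hv : Algebra.IsUnramifiedIn (𝓞 L) v.asIdeal)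
    {c : w.1.adicCompletion L} (hc0 : c ≠ 0) (hc1 : valuation (w.1.adicCompletion L) c < 1)
    (f : ((cmDatum L 2 (Matrix.of fun i j : Fin 2 => if i.val + j.val + 1 = 2 then (1 : L) else 0)).Local v × (cmDatum L 1 (Matrix.of fun i j : Fin 1 => if i.val + j.val + 1 = 1 then (1 : L) else 0)).Local v) → ℂ) (hfc : Continuous f) (hfK : Function.support f ⊆ ((((cmLocalIntegralLevel L 2 (Matrix.of fun i j : Fin 2 => if i.val + j.val + 1 = 2 then (1 : L) else 0) v).prod (cmLocalIntegralLevel L 1 (Matrix.of fun i j : Fin 1 => if i.val + j.val + 1 = 1 then (1 : L) else 0) v) : Subgroup ((cmDatum L 2 (Matrix.of fun i j : Fin 2 => if i.val + j.val + 1 = 2 then (1 : L) else 0)).Local v × (cmDatum L 1 (Matrix.of fun i j : Fin 1 => if i.val + j.val + 1 = 1 then (1 : L) else 0)).Local v))) : Set ((cmDatum L 2 (Matrix.of fun i j : Fin 2 => if i.val + j.val + 1 = 2 then (1 : L) else 0)).Local v × (cmDatum L 1 (Matrix.of fun i j : Fin 1 => if i.val + j.val + 1 = 1 then (1 : L) else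 0)).Local v)))
    (hfinv : ∀ k ∈ (((cmLocalIntegralLevel L 2 (Matrix.of fun i j : Fin 2 => if i.val + j.val + 1 = 2 then (1 : L) else 0) v).prod (cmLocalIntegralLevel L 1 (Matrix.of fun i j : Fin 1 => if i.val + j.val + 1 = 1 then (1 : L) else 0) v) : Subgroup ((cmDatum L 2 (Matrix.of fun i j : Fin 2 => if i.val + j.val + 1 = 2 then (1 : L) else 0)).Local v × (cmDatum L 1 (Matrix.of fun i j : Fin 1 => if i.val + j.val + 1 = 1 then (1 : L) else 0)).Local v))), ∀ x, f (k * x * k⁻¹) = f x)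
    (hf1 : ∀ x ∈ (((cmLocalIntegralLevel L 2 (Matrix.of fun i j : Fin 2 => if i.val + j.val + 1 = 2 then (1 : L) else 0) v).prod (cmLocalIntegralLevel L 1 (Matrix.of fun i j : Fin 1 => if i.val + j.val + 1 = 1 then (1 : L) else 0) v) : Subgroup ((cmDatum L 2 (Matrix.of fun i j : Fin 2 => if i.val + j.val + 1 = 2 then (1 : L) else 0)).Local v × (cmDatum L 1 (Matrix.of fun i j : Fin 1 => if i.val + j.val + 1 = 1 then (1 : L) else 0)).Local v))), (∀ a b, valuation (w.1.adicCompletion L) (((((((localNonsplitEquiv (IsCMField.complexConj L) (Matrix.of fun i j : Fin 2 => if i.val + j.val + 1 = 2 then (1 : L) else 0) (IsCMField.complexConj_ne_one L) w hw) x.1 : ↥(unitaryGroupOfForm (galAdicCompletionMap (L := L) (IsCMField.complexConj L) hw) (placeForm (Matrix.of fun i j : Fin 2 => if i.val + j.val + 1 = 2 then (1 : L) else 0) w.1))) : GL (Fin 2) (w.1.adicCompletion L))) : Matrix (Fin 2) (Fin 2) (w.1.adicCompletion L)) - 1) a b) ≤ valuation (w.1.adicCompletion L) c) → f x = 1)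
    (hf0 : ∀ x ∈ (((cmLocalIntegralLevel L 2 (Matrix.of fun i j : Fin 2 => if i.val + j.val + 1 = 2 then (1 : L) else 0) v).prod (cmLocalIntegralLevel L 1 (Matrix.of fun i j : Fin 1 => if i.val + j.val + 1 = 1 then (1 : L) else 0) v) : Subgroup ((cmDatum L 2 (Matrix.of fun i j : Fin 2 => if i.val + j.val + 1 = 2 then (1 : L) else 0)).Local v × (cmDatum L 1 (Matrix.of fun i j : Fin 1 => if i.val + j.val + 1 = 1 then (1 : L) else 0)).Local v))), ¬ (∀ a b, valuation (w.1.adicCompletion L) (((((((localNonsplitEquiv (IsCMField.complexConj L) (Matrix.of fun i j : Fin 2 => if i.val + j.val + 1 = 2 then (1 : L) else 0) (IsCMField.complexConj_ne_one L) w hw) x.1 : ↥(unitaryGroupOfForm (galAdicCompletionMap (L := L) (IsCMField.complexConj L) hw) (placeForm (Matrix.of fun i j : Fin 2 => if i.val + j.val + 1 = 2 then (1 : L) else 0) w.1))) : GL (Fin 2) (w.1.adicCompletion L))) : Matrix (Fin 2) (Fin 2) (w.1.adicCompletion L)) - 1) a b) ≤ valuation (w.1.adicCompletion L) c) → f x =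 0) :
    classOrbitalIntegral mH f (ConjClasses.mk γH) =
      ({Λ : Submodule 𝒪[w.1.adicCompletion L] (Fin 2 → w.1.adicCompletion L) |
        (∃ g : GL (Fin 2) (w.1.adicCompletion L),
          (∃ J' ∈ glInt 2 (w.1.adicCompletion L), (J' : Matrix (Fin 2) (Fin 2) (w.1.adicCompletion L)) =
            formCongr (galAdicCompletionMap (L := L) (IsCMField.complexConj L) hw) g (placeForm (Matrix.of fun i j : Fin 2 => if i.val + j.val + 1 = 2 then (1 : L) else 0) w.1)) ∧
          Λ = Submodule.span 𝒪[w.1.adicCompletion L] (Set.range ((g : Matrix (Fin 2) (Fin 2) (w.1.adicCompletion L)))ᵀ)) ∧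
        Λ.map ((Matrix.toLin' ((((localNonsplitEquiv (IsCMField.complexConj L) (Matrix.of fun i j : Fin 2 => if i.val + j.val + 1 = 2 then (1 : L) else 0) (IsCMField.complexConj_ne_one L) w hw) γH.1 : ↥(unitaryGroupOfForm (galAdicCompletionMap (L := L) (IsCMField.complexConj L) hw) (placeForm (Matrix.of fun i j : Fin 2 => if i.val + j.val + 1 = 2 then (1 : L) else 0) w.1))) : GL (Fin 2) (w.1.adicCompletion L)) : Matrix (Fin 2) (Fin 2) (w.1.adicCompletion L))).restrictScalars 𝒪[w.1.adicCompletion L]) = Λ ∧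
        Λ.map ((Matrix.toLin' (1 + c⁻¹ • (((((localNonsplitEquiv (IsCMField.complexConj L) (Matrix.of fun i j : Fin 2 => if i.val + j.val + 1 = 2 then (1 : L) else 0) (IsCMField.complexConj_ne_one L) w hw) γH.1 : ↥(unitaryGroupOfForm (galAdicCompletionMap (L := L) (IsCMField.complexConj L) hw) (placeForm (Matrix.of fun i j : Fin 2 => if i.val + j.val + 1 = 2 then (1 : L) else 0) w.1))) : GL (Fin 2) (w.1.adicCompletion L)) : Matrix (Fin 2) (Fin 2) (w.1.adicCompletion L)) - 1))).restrictScalars 𝒪[w.1.adicCompletion L]) ≤ Λ}.ncard : ℂ) := by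
  classical
  -- compact centralisers: `U(Φ₁)_v` is compact at a non-split place, `Z(γ_H) = Z(γ₂) × Z(γ₁)`
  haveI : CompactSpace ((cmDatum L 1 (Matrix.of fun i j : Fin 1 => if i.val + j.val + 1 = 1 then (1 : L) else 0)).Local v) :=
    compactSpace_cmDatum_local_one_of_smul_eq L (Matrix.of fun i j : Fin 1 => if i.val + j.val + 1 = 1 then (1 : L) else 0) w hw (isUnit_placeForm_antidiagOne (E := L) 1 w.1)
  haveI : CompactSpace (Subgroup.centralizer ({γH.2} : Set ((cmDatum L 1 (Matrix.of fun i j : Fin 1 => if i.val + j.val + 1 = 1 then (1 : L) else 0)).Local v))) :=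
    isCompact_iff_compactSpace.1 (isClosed_coe_centralizer_singleton γH.2).isCompact
  haveI : CompactSpace (Subgroup.centralizer ({γH} : Set ((cmDatum L 2 (Matrix.of fun i j : Fin 2 => if i.val + j.val + 1 = 2 then (1 : L) else 0)).Local v × (cmDatum L 1 (Matrix.of fun i j : Fin 1 => if i.val + j.val + 1 = 1 then (1 : L) else 0)).Local v))) := compactSpace_centralizer_prod γH.1 γH.2
  have hKco := isCompact_isOpen_cmLocalIntegralLevel_prod L 2 1 (Matrix.of fun i j : Fin 2 => if i.val + j.val + 1 = 2 then (1 : L) else 0) (Matrix.of fun i j : Fin 1 => if i.val + j.val + 1 = 1 then (1 : L) else 0) v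
  have hO := isClosed_conjClass_localH_of_isLocalGRegular L v γH hγ
  rw [classOrbitalIntegral_eq_sum_fixedBy_of_support_subset_of_conj_invariant_of_measure_eq_one (P := IsLocalGRegular L v)
    (fun _ x hg => isLocalGRegular_of_isConj (isConj_iff.2 ⟨x, rfl⟩) hg) hmH hγ _ hKco.2 hKco.1 hνH hO f hfc hfK hfinv]
  have hfin := finite_fixedBy_quotient_of_isClosed γH _ hO hKco.2 hKco.1
  have hfY : ∀ q ∈ MulAction.fixedBy (((cmDatum L 2 (Matrix.of fun i j : Fin 2 => if i.val + j.val + 1 = 2 then (1 : L) else 0)).Local v × (cmDatum L 1 (Matrix.of fun i j : Fin 1 => if i.val + j.val + 1 = 1 then (1 : L) else 0)).Local v) ⧸ (((cmLocalIntegralLevel L 2 (Matrix.of fun i j : Fin 2 => if i.val + j.val + 1 = 2 then (1 : L) else 0) v).prod (cmLocalIntegralLevel L 1 (Matrix.of fun i j : Fin 1 => if i.val + j.val + 1 = 1 then (1 : L) else 0) v) : Subgroup ((cmDatum L 2 (Matrix.of fun i j : Fin 2 => if i.val + j.val + 1 = 2 then (1 : L) else 0)).Local v × (cmDatum L 1 (Matrix.of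 fun i j : Fin 1 => if i.val + j.val + 1 = 1 then (1 : L) else 0)).Local v)))) γH,
      f (q.out⁻¹ * γH * q.out) = if (∀ a b, valuation (w.1.adicCompletion L) (((((((localNonsplitEquiv (IsCMField.complexConj L) (Matrix.of fun i j : Fin 2 => if i.val + j.val + 1 = 2 then (1 : L) else 0) (IsCMField.complexConj_ne_one L) w hw) (q.out⁻¹ * γH * q.out).1 : ↥(unitaryGroupOfForm (galAdicCompletionMap (L := L) (IsCMField.complexConj L) hw) (placeForm (Matrix.of fun i j : Fin 2 => if i.val + j.val + 1 = 2 then (1 : L) else 0) w.1))) : GL (Fin 2) (w.1.adicCompletion L))) : Matrix (Fin 2) (Fin 2) (w.1.adicCompletion L)) - 1) a b) ≤ valuation (w.1.adicCompletion L) c) then 1 else 0 := fun q hq => by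
    have hmem : q.out⁻¹ * γH * q.out ∈ (((cmLocalIntegralLevel L 2 (Matrix.of fun i j : Fin 2 => if i.val + j.val + 1 = 2 then (1 : L) else 0) v).prod (cmLocalIntegralLevel L 1 (Matrix.of fun i j : Fin 1 => if i.val + j.val + 1 = 1 then (1 : L) else 0) v) : Subgroup ((cmDatum L 2 (Matrix.of fun i j : Fin 2 => if i.val + j.val + 1 = 2 then (1 : L) else 0)).Local v × (cmDatum L 1 (Matrix.of fun i j : Fin 1 => if i.val + j.val + 1 = 1 then (1 : L) else 0)).Local v))) := inv_mul_mul_mem_of_smul_eq Quotient.out QuotientGroup.out_eq' γH hq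
    by_cases hYq : (∀ a b, valuation (w.1.adicCompletion L) (((((((localNonsplitEquiv (IsCMField.complexConj L) (Matrix.of fun i j : Fin 2 => if i.val + j.val + 1 = 2 then (1 : L) else 0) (IsCMField.complexConj_ne_one L) w hw) (q.out⁻¹ * γH * q.out).1 : ↥(unitaryGroupOfForm (galAdicCompletionMap (L := L) (IsCMField.complexConj L) hw) (placeForm (Matrix.of fun i j : Fin 2 => if i.val + j.val + 1 = 2 then (1 : L) else 0) w.1))) : GL (Fin 2) (w.1.adicCompletion L))) : Matrix (Fin 2) (Fin 2) (w.1.adicCompletion L)) - 1) a b) ≤ valuation (w.1.adicCompletion L) c)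
    · rw [if_pos hYq]; exact hf1 _ hmem hYq
    · rw [if_neg hYq]; exact hf0 _ hmem hYq
  rw [finsum_mem_fixedBy_eq_ncard_sep _ hfin (fun x : ((cmDatum L 2 (Matrix.of fun i j : Fin 2 => if i.val + j.val + 1 = 2 then (1 : L) else 0)).Local v × (cmDatum L 1 (Matrix.of fun i j : Fin 1 => if i.val + j.val + 1 = 1 then (1 : L) else 0)).Local v) => (∀ a b, valuation (w.1.adicCompletion L) (((((((localNonsplitEquiv (IsCMField.complexConj L) (Matrix.of fun i j : Fin 2 => if i.val + j.val + 1 = 2 then (1 : L) else 0) (IsCMField.complexConj_ne_one L) w hw) x.1 : ↥(unitaryGroupOfForm (galAdicCompletionMap (L := L) (IsCMField.complexConj L) hw) (placeForm (Matrix.of fun i j : Fin 2 => if i.val + j.val + 1 = 2 then (1 : L) else 0) w.1))) : GL (Fin 2) (w.1.adicCompletion L))) : Matrix (Fin 2) (Fin 2) (w.1.adicCompletion L)) - 1) a b) ≤ valuation (w.1.adicCompletion L) c)) f hfY]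
  congr 1
  exact ncard_sep_fixedBy_prod_level_eq_ncard_selfDual_level L v γH w hw hv hc0 hc1

end H

end Literature.NumberTheory.Automorphic

end
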